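import Mathlib
import Summits.Ventures.PercRepro2.Defs
import Summits.Ventures.PercRepro2.Independence
import Summits.Ventures.PercRepro2.Harris
import Summits.Ventures.PercRepro2.Graph
import Summits.Ventures.PercRepro2.Exploration
import Summits.Ventures.PercRepro2.Events
import Summits.Ventures.PercRepro2.Statements
import Summits.Ventures.PercRepro2.FourFunctions
import Summits.Ventures.PercRepro2.Induced
import Summits.Ventures.PercRepro2.Frontier
import Summits.Ventures.PercRepro2.ObsIndependence
import Summits.Ventures.PercRepro2.BHK
import Summits.Ventures.PercRepro2.BHKEvents
import Summits.Ventures.PercRepro2.ClusterProperty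
import Summits.Ventures.PercRepro2.BHKPair
import Summits.Ventures.PercRepro2.CondAvoidPA
import Summits.Ventures.PercRepro2.CondAvoidZPA
import Summits.Ventures.PercRepro2.BoxUnionDefs
import Summits.Ventures.PercRepro2.BoxUnion
import Summits.Ventures.PercRepro2.BoxUnionPair
import Summits.Ventures.PercRepro2.PairTP2
import Summits.Ventures.PercRepro2.PairTP2Main
import Summits.Ventures.PercRepro2.UnionRowMech
import Summits.Ventures.PercRepro2.UnionRowMech2
import Summits.Ventures.PercRepro2.UnionRowMech3
import Summits.Ventures.PercRepro2.UnionRowMech4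
import Summits.Ventures.PercRepro2.UnionRowMech5
import Summits.Ventures.PercRepro2.UnionRowGrid
import Summits.Ventures.PercRepro2.UnionRowGrid2
import Summits.Ventures.PercRepro2.UnionRowGrid3
import Summits.Ventures.PercRepro2.UnionRowCellDefs
import Summits.Ventures.PercRepro2.UnionRowCell
import Summits.Ventures.PercRepro2.UnionRowBilinear
import Summits.Ventures.PercRepro2.UnionRowGeneral
import Summits.Ventures.PercRepro2.UnionRowFull

/-!
# The two-status union row for monotone functions of the two statuses
(blind cell PercRepro2, mine-1 g40; proofs/MINE1-UNIONROW2.md §8)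

The packet form of `UnionRowCell.union_row_nonneg_general_full`: an observable of the two
statuses is a function `φ : Fin 3 × Fin 3 → ℝ` of the codes `(fcode W C u, fcode W C v)`
(`T = 0 < N = 1 < S = 2`; `fcode_mono`), and a MONOTONE `φ` gives an observable increasing in
`C_s` and decreasing in `C_t`. THEOREM `union_row_nonneg_status`: for `u ≠ v`, every admissible
weight vector with `P(s ↮ t) > 0`, all `X, Y ⊆ {u, v}` and all monotone `φ, ψ` on the status
grid, `E[(φ(σ) − E[φ(σ) | Q]) (ψ(σ) − E[ψ(σ) | Q]) · 1_{Q ∩ ({s ↮ X} ∪ {t ↮ Y})}] ≥ 0`.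
-/

namespace Summit.Ventures.PercRepro2

namespace UnionRowCell

open Finset UnionRowMech UnionRowGrid
open scoped Classical

variable {V : Type*} {E : Type*} [Fintype V] [DecidableEq V] [Fintype E] [DecidableEq E]
variable (ends : E → Sym2 V) (s t u v : V) {p : E → ℝ}

/-- The observable of the two statuses defined by a function on the status grid. -/
def statusObs (φ : Grid → ℝ) (W C : Finset V) : ℝ := φ (fcode W C u, fcode W C v)

omit [Fintype V] [Fintype E] [DecidableEq E] in
/-- A monotone function of the two statuses is increasing in `C_s` and decreasing in `C_t`. -/
lemma statusObs_zmono {φ : Grid → ℝ} (hφ : Monotone φ) :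
    ∀ ⦃W W' C C' : Finset V⦄, W ⊆ W' → C' ⊆ C → statusObs u v φ W C ≤ statusObs u v φ W' C' :=
  fun _ _ _ _ hW hC => hφ ⟨fcode_mono hW hC u, fcode_mono hW hC v⟩

/-- **The two-status union row for monotone functions of the two statuses, on every graph, for
every union type.** -/
theorem union_row_nonneg_status (hne : u ≠ v) (hp : IsProbVec p)
    (hQ : 0 < prob p (connEvent ends s t)ᶜ) {X Y : Finset V} (hX : X ⊆ {u, v})
    (hY : Y ⊆ {u, v}) {φ ψ : Grid → ℝ} (hφ : Monotone φ) (hψ : Monotone ψ) :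
    0 ≤ expect p (((connEvent ends s t)ᶜ ∩ ((hitEvent ends s X)ᶜ ∪ (hitEvent ends t Y)ᶜ)).indicator
      (fun ω =>
        (statusObs u v φ (BoxUnionPair.status ends {u, v} s t ω).1
              (OrderDual.ofDual (BoxUnionPair.status ends {u, v} s t ω).2) -
            BoxUnionPair.condMean p ends {u, v} s t
              (fun k => statusObs u v φ k.1 (OrderDual.ofDual k.2))) *
          (statusObs u v ψ (BoxUnionPair.status ends {u, v} s t ω).1
              (OrderDual.ofDual (BoxUnionPair.status ends {u, v} s t ω).2) -
            BoxUnionPair.condMean p ends {u, v} s t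
              (fun k => statusObs u v ψ k.1 (OrderDual.ofDual k.2))))) :=
  union_row_nonneg_general_full ends s t u v hne hp hQ hX hY (statusObs_zmono u v hφ)
    (statusObs_zmono u v hψ)

end UnionRowCell

end Summit.Ventures.PercRepro2
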